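import Mathlib.Tactic
import HarnessLib

/-!
# Kozma–Nitzan's Question 8 at three relays — the SURE-BIT ELIMINATION lemmas (abstract, finite)

Support file (`--supports stmt-CriticalPhenomena-4575`, closed crux; independent mathematics on Kozma–Nitzan's Question 8,
arXiv:2401.12397 §5.5 p. 36), prover `prim-ineq-gen-6` (gen 20).  No definitions, no named facts, no sorries; standard axioms.
Memo `run/shared/lean/prim/prim-ineq-gen-6/FINDING-G20.md` §2–§3 (and FINDING-G18 §5, the `v`-elimination lemma).
In the block analysis of the centring functional the coefficient of an increasing test function is a signed measure `w` on a cube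
`2^{z ∪ V}` = `Bool × (2^V)` with a distinguished 'sure bit' `z` (the marker `v`, or the root of a pendant path); positivity on every
up-set of the cube is reduced to statements on the smaller cube `2^V`:
* `upperSets_nonneg_boolProd_of_witness` — if a pointwise nonnegative `ν` on `β` satisfies `Σ_V w(true,·) ≥ Σ_V ν ≥ −Σ_V w(false,·)` on every
  up-set `V` of `β`, then `w` has nonnegative mass on every up-set of `Bool × β` (gen 18's `v`-ELIMINATION LEMMA; the star proof's `G₀`-elimination
  is the witness `ν = TOP_tot · K_out`);
* `upperSets_nonneg_boolProd_iff_of_nonpos` — if the bit-less layer is pointwise `≤ 0` the elimination is EXACT: positivity on the up-sets of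
  `Bool × β` is equivalent to positivity of the folded weight `w(true,·) + w(false,·)` on the up-sets of `β` (FINDING-G20 §3(i), the step of the
  path chain behind THEOREM 5a: for path-end blocks the C2 corner holds iff it holds for the single-site functionals).
Here `β` is any finite preorder and `Bool × β` carries the product order (`false < true`).
[cite: KozmaNitzan2024, Question 8 (§5.5 p. 36)]
-/

namespace Summit.CriticalPhenomena.PercolationContinuityZ3.Theorems

namespace PocketCert

open Finset

variable {β : Type*} [Fintype β] [Preorder β]

omit [Preorder β] in
/-- Fibrewise summation over a subset of `Bool × β`: the `true`-layer plus the `false`-layer.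
[cite: KozmaNitzan2024, Question 8 (§5.5 p. 36)] -/
theorem sum_boolProd_eq_fib [DecidableEq β] (U : Finset (Bool × β)) (w : Bool × β → ℝ) :
    ∑ p ∈ U, w p = ∑ b ∈ univ.filter (fun b => (true, b) ∈ U), w (true, b)
      + ∑ b ∈ univ.filter (fun b => (false, b) ∈ U), w (false, b) := by
  classical
  have h1 : ∑ p ∈ U, w p = ∑ p : Bool × β, if p ∈ U then w p else 0 := by
    rw [← Finset.sum_filter, Finset.filter_univ_mem]
  rw [h1, Fintype.sum_prod_type, Fintype.sum_bool, Finset.sum_filter, Finset.sum_filter]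

omit [Fintype β] in
/-- Each layer of an up-set of `Bool × β` is an up-set of `β`. [cite: KozmaNitzan2024, Question 8 (§5.5 p. 36)] -/
theorem fib_bool_isUpperSet [Fintype β] [DecidableEq β] (U : Finset (Bool × β))
    (hU : IsUpperSet (U : Set (Bool × β))) (c : Bool) :
    IsUpperSet ((univ.filter fun b => (c, b) ∈ U : Finset β) : Set β) := by
  intro b b' hbb' hb
  have hb2 : (c, b) ∈ U := (mem_filter.1 (Finset.mem_coe.1 hb)).2
  have hle : (c, b) ≤ (c, b') := ⟨le_rfl, hbb'⟩
  exact Finset.mem_coe.2 (mem_filter.2 ⟨mem_univ _, Finset.mem_coe.1 (hU hle (Finset.mem_coe.2 hb2))⟩)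

omit [Fintype β] in
/-- The `false`-layer of an up-set of `Bool × β` is contained in its `true`-layer. [cite: KozmaNitzan2024, Question 8 (§5.5 p. 36)] -/
theorem fib_false_subset_fib_true [Fintype β] [DecidableEq β] (U : Finset (Bool × β))
    (hU : IsUpperSet (U : Set (Bool × β))) :
    (univ.filter fun b => (false, b) ∈ U : Finset β) ⊆ univ.filter fun b => (true, b) ∈ U := by
  intro b hb
  have hb2 : (false, b) ∈ U := (mem_filter.1 hb).2
  have hle : (false, b) ≤ (true, b) := ⟨Bool.false_le _, le_rfl⟩
  exact mem_filter.2 ⟨mem_univ _, Finset.mem_coe.1 (hU hle (Finset.mem_coe.2 hb2))⟩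

/-- **The `v`-elimination lemma** (FINDING-G18 §5, FINDING-G20 §2).  Let `w` be a signed weight on `Bool × β` and `ν ≥ 0` a pointwise nonnegative
weight on `β` such that on every up-set `V` of `β`:  `Σ_V ν ≤ Σ_V w(true,·)` and `−Σ_V w(false,·) ≤ Σ_V ν`.  Then `w` has nonnegative mass on
every up-set of `Bool × β`.  [Layers `U₀ ⊆ U₁` of the up-set; `Σ_U w = Σ_{U₁} w(true,·) + Σ_{U₀} w(false,·) ≥ Σ_{U₁} ν − Σ_{U₀} ν ≥ 0`.]
[cite: KozmaNitzan2024, Question 8 (§5.5 p. 36)] -/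
theorem upperSets_nonneg_boolProd_of_witness [DecidableEq β] (w : Bool × β → ℝ) (ν : β → ℝ) (hν : ∀ b, 0 ≤ ν b)
    (h1 : ∀ V : Finset β, IsUpperSet (V : Set β) → ∑ b ∈ V, ν b ≤ ∑ b ∈ V, w (true, b))
    (h0 : ∀ V : Finset β, IsUpperSet (V : Set β) → -∑ b ∈ V, w (false, b) ≤ ∑ b ∈ V, ν b)
    (U : Finset (Bool × β)) (hU : IsUpperSet (U : Set (Bool × β))) :
    0 ≤ ∑ p ∈ U, w p := by
  classical
  rw [sum_boolProd_eq_fib]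
  set U1 : Finset β := univ.filter fun b => (true, b) ∈ U with hU1
  set U0 : Finset β := univ.filter fun b => (false, b) ∈ U with hU0
  have hup1 : IsUpperSet (U1 : Set β) := fib_bool_isUpperSet U hU true
  have hup0 : IsUpperSet (U0 : Set β) := fib_bool_isUpperSet U hU false
  have hsub : U0 ⊆ U1 := fib_false_subset_fib_true U hU
  have hA : ∑ b ∈ U1, ν b ≤ ∑ b ∈ U1, w (true, b) := h1 U1 hup1
  have hB : -∑ b ∈ U0, w (false, b) ≤ ∑ b ∈ U0, ν b := h0 U0 hup0
  have hC : ∑ b ∈ U0, ν b ≤ ∑ b ∈ U1, ν b :=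
    Finset.sum_le_sum_of_subset_of_nonneg hsub fun b _ _ => hν b
  linarith

/-- **Exact elimination of a sure bit** (FINDING-G20 §3(i)).  If the bit-less layer is pointwise nonpositive, `w(false,·) ≤ 0`, then `w` has
nonnegative mass on every up-set of `Bool × β` if and only if the FOLDED weight `w(true,·) + w(false,·)` has nonnegative mass on every up-set
of `β`.  [⇐: the witness `ν = −w(false,·)`; ⇒: the cylinder `Bool × V` over an up-set `V` is an up-set.]
[cite: KozmaNitzan2024, Question 8 (§5.5 p. 36)] -/
theorem upperSets_nonneg_boolProd_iff_of_nonpos [DecidableEq β] (w : Bool × β → ℝ) (hneg : ∀ b, w (false, b) ≤ 0) :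
    (∀ U : Finset (Bool × β), IsUpperSet (U : Set (Bool × β)) → 0 ≤ ∑ p ∈ U, w p) ↔
      ∀ V : Finset β, IsUpperSet (V : Set β) → 0 ≤ ∑ b ∈ V, (w (true, b) + w (false, b)) := by
  classical
  constructor
  · intro h V hV
    -- the cylinder over V
    let U : Finset (Bool × β) := univ.filter fun p => p.2 ∈ V
    have hU : IsUpperSet (U : Set (Bool × β)) := by
      intro p q hpq hp
      have hp2 : p.2 ∈ V := (mem_filter.1 (Finset.mem_coe.1 hp)).2
      have hq2 : q.2 ∈ V := Finset.mem_coe.1 (hV hpq.2 (Finset.mem_coe.2 hp2))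
      exact Finset.mem_coe.2 (mem_filter.2 ⟨mem_univ _, hq2⟩)
    have hsum := h U hU
    rw [sum_boolProd_eq_fib] at hsum
    have ht : (univ.filter fun b => (true, b) ∈ U) = V := by
      ext b; simp [U]
    have hf : (univ.filter fun b => (false, b) ∈ U) = V := by
      ext b; simp [U]
    rw [ht, hf] at hsum
    rw [Finset.sum_add_distrib]
    exact hsum
  · intro h U hU
    refine upperSets_nonneg_boolProd_of_witness w (fun b => -w (false, b)) (fun b => by linarith [hneg b]) ?_ ?_ U hU
    · intro V hV
      have := h V hV
      rw [Finset.sum_add_distrib] at this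
      rw [Finset.sum_neg_distrib]
      linarith
    · intro V hV
      rw [Finset.sum_neg_distrib]

end PocketCert

end Summit.CriticalPhenomena.PercolationContinuityZ3.Theorems
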